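import Summits.KontsevichZagierPeriods.KontsevichZagierPeriods.Theorems.PlanarAreas.Negative.GreenBandsLoadBearing

/-!
# `PlanarAreas` (stmt-KontsevichZagierPeriods-4990), line `green-native-bands`: load-bearing
# hypotheses of the engine stub, skeleton v3

The lead's skeleton v3 (`Cruxes/PlanarAreas/Lines/green-native-bands.lean`, stubs registered
2026-08-16T02:23Z, sha 495091be93cf) changes exactly one stub: `stub_bandNewtonLeibniz` gains the
hypothesis `∃ M, ∀ p ∈ r.domain, |F p| ≤ M` (the primitive is BOUNDED on the band; it makes the base
pieces `F(ξ_{k+1}) − F(ξ_k)` trivially integrable). The three load-bearing deletions certified for v2 in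
`GreenBandsLoadBearing.lean` are re-certified here against the v3 signature, with the same witnesses
(all of them have `|F| ≤ 1`): `not_bandNLv3WithoutNullZ`, `not_bandNLv3WithoutFibreContinuity`,
`not_bandNLv3WithoutLE`. (The added boundedness hypothesis itself is a convenience, not a load: the v2
statement is true on paper — `|F(ξ_{k+1}) − F(ξ_k)| ≤ ∫ |r.integrand|` over the sub-fibre for a.e. base
point, integrable by Tonelli. It does FAIL for the primitive `F = y` on finite-area cells with
unbounded fibres, e.g. `{0 < t < 1, 0 < s < t^{-1/2}}`, so the v3 engine is not the tool for such cells
of `stub_areaSlicing`; the tree's `KZ.exists_band_sub_base_mem_newtonLeibnizRel` is.)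
-/

noncomputable section

open Set MeasureTheory MvPolynomial Filter Topology
open Literature.NumberTheory.Transcendental Literature.ModelTheory.ExponentialFields

namespace Summit.KontsevichZagierPeriods.PlanarAreas.Negative.GreenBands

/-! ## (1) `volume Z = 0` -/

/-- v3 `stub_bandNewtonLeibniz` with the hypothesis `volume Z = 0` DELETED (everything else verbatim). -/
def BandNLv3WithoutNullZ : Prop := ∀ (a₀ a₁ : ℚ) (α β : ℝ → ℝ) (F : (Fin 2 → ℝ) → ℝ)
    (Z : Set (Fin 2 → ℝ)) (r : KZ.IntegralRep 2), a₀ < a₁ →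
    IsSemialgebraicFunOn ℚ {z : Fin 1 → ℝ | z 0 ∈ Set.Ioo (a₀ : ℝ) a₁} (fun z => α (z 0)) →
    IsSemialgebraicFunOn ℚ {z : Fin 1 → ℝ | z 0 ∈ Set.Ioo (a₀ : ℝ) a₁} (fun z => β (z 0)) →
    (∀ t ∈ Set.Ioo (a₀ : ℝ) a₁, α t ≤ β t) →
    r.domain = {p : Fin 2 → ℝ | p 0 ∈ Set.Icc (a₀ : ℝ) a₁ ∧ α (p 0) ≤ p 1 ∧ p 1 ≤ β (p 0)} →
    IsSemialgebraicFunOn ℚ r.domain F → (∃ M : ℝ, ∀ p ∈ r.domain, |F p| ≤ M) →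
    (∀ t ∈ Set.Ioo (a₀ : ℝ) a₁, ContinuousOn (fun s : ℝ => F ![t, s]) (Set.Icc (α t) (β t))) →
    IsSemialgebraic ℚ Z →
    (∀ p ∈ r.domain, p 0 ∈ Set.Ioo (a₀ : ℝ) a₁ → α (p 0) < p 1 → p 1 < β (p 0) → p ∉ Z →
      HasDerivAt (fun s : ℝ => F ![p 0, s]) (r.integrand p) (p 1)) →
    ∃ r' : KZ.IntegralRep 1, r'.domain = {z : Fin 1 → ℝ | z 0 ∈ Set.Ioo (a₀ : ℝ) a₁} ∧
      (∀ z ∈ r'.domain, r'.integrand z = F ![z 0, β (z 0)] - F ![z 0, α (z 0)]) ∧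
      KZ.of r - KZ.of r' ∈ KZ.relations

/-- **`volume Z = 0` is load-bearing in the v3 engine** (witness as in `not_bandNLWithoutNullZ`:
`Z = univ`, `F = y` with `|F| ≤ 1` on the closed unit square, integrand `0`). -/
theorem not_bandNLv3WithoutNullZ : ¬ BandNLv3WithoutNullZ := by
  intro h
  have hb : IsSemialgebraic ℚ {z : Fin 1 → ℝ | z 0 ∈ Set.Ioo ((0 : ℚ) : ℝ) ((1 : ℚ) : ℝ)} :=
    isSemialgebraic_baseSet
  have hα : IsSemialgebraicFunOn ℚ {z : Fin 1 → ℝ | z 0 ∈ Set.Ioo ((0 : ℚ) : ℝ) ((1 : ℚ) : ℝ)}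
      (fun z => (fun _ : ℝ => (0 : ℝ)) (z 0)) := by
    simpa using isSemialgebraicFunOn_natCast hb 0
  have hβ : IsSemialgebraicFunOn ℚ {z : Fin 1 → ℝ | z 0 ∈ Set.Ioo ((0 : ℚ) : ℝ) ((1 : ℚ) : ℝ)}
      (fun z => (fun _ : ℝ => (1 : ℝ)) (z 0)) := by
    simpa using isSemialgebraicFunOn_natCast hb 1
  have hbd : ∃ M : ℝ, ∀ p ∈ zeroSquare.domain, |(fun p : Fin 2 → ℝ => p 1) p| ≤ M :=
    ⟨1, fun p hp => abs_le.mpr ⟨by linarith [hp.2.2.1], hp.2.2.2⟩⟩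
  obtain ⟨r', hd, hi, hrel⟩ := h 0 1 (fun _ => 0) (fun _ => 1) (fun p => p 1) univ zeroSquare
    zero_lt_one hα hβ (fun t _ => zero_le_one) closedSquareSet_eq_band isSemialgebraicFunOn_snd hbd
    (fun t _ => continuousOn_id.congr fun s _ => by simp) isSemialgebraic_univ
    (fun p _ _ _ _ hZ => (hZ (mem_univ p)).elim)
  have hv : zeroSquare.value = r'.value := KZ.Equivalent.value_eq_holds hrel
  rw [value_zeroSquare, value_eq_of_const hd 1 fun z hz => by rw [hi z hz]; simp] at hv
  exact zero_ne_one hv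

/-! ## (2) Closed-fibre continuity -/

/-- v3 `stub_bandNewtonLeibniz` with the fibrewise-continuity hypothesis DELETED. -/
def BandNLv3WithoutFibreContinuity : Prop := ∀ (a₀ a₁ : ℚ) (α β : ℝ → ℝ) (F : (Fin 2 → ℝ) → ℝ)
    (Z : Set (Fin 2 → ℝ)) (r : KZ.IntegralRep 2), a₀ < a₁ →
    IsSemialgebraicFunOn ℚ {z : Fin 1 → ℝ | z 0 ∈ Set.Ioo (a₀ : ℝ) a₁} (fun z => α (z 0)) →
    IsSemialgebraicFunOn ℚ {z : Fin 1 → ℝ | z 0 ∈ Set.Ioo (a₀ : ℝ) a₁} (fun z => β (z 0)) →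
    (∀ t ∈ Set.Ioo (a₀ : ℝ) a₁, α t ≤ β t) →
    r.domain = {p : Fin 2 → ℝ | p 0 ∈ Set.Icc (a₀ : ℝ) a₁ ∧ α (p 0) ≤ p 1 ∧ p 1 ≤ β (p 0)} →
    IsSemialgebraicFunOn ℚ r.domain F → (∃ M : ℝ, ∀ p ∈ r.domain, |F p| ≤ M) →
    IsSemialgebraic ℚ Z → volume Z = 0 →
    (∀ p ∈ r.domain, p 0 ∈ Set.Ioo (a₀ : ℝ) a₁ → α (p 0) < p 1 → p 1 < β (p 0) → p ∉ Z →
      HasDerivAt (fun s : ℝ => F ![p 0, s]) (r.integrand p) (p 1)) →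
    ∃ r' : KZ.IntegralRep 1, r'.domain = {z : Fin 1 → ℝ | z 0 ∈ Set.Ioo (a₀ : ℝ) a₁} ∧
      (∀ z ∈ r'.domain, r'.integrand z = F ![z 0, β (z 0)] - F ![z 0, α (z 0)]) ∧
      KZ.of r - KZ.of r' ∈ KZ.relations

/-- **Closed-fibre continuity of `F` is load-bearing in the v3 engine** (witness as in
`not_bandNLWithoutFibreContinuity`: the jump primitive `F = 𝟙{y ≥ 1}`, `|F| ≤ 1`, `Z = ∅`, integrand `0`). -/
theorem not_bandNLv3WithoutFibreContinuity : ¬ BandNLv3WithoutFibreContinuity := by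
  intro h
  have hb : IsSemialgebraic ℚ {z : Fin 1 → ℝ | z 0 ∈ Set.Ioo ((0 : ℚ) : ℝ) ((1 : ℚ) : ℝ)} :=
    isSemialgebraic_baseSet
  have hα : IsSemialgebraicFunOn ℚ {z : Fin 1 → ℝ | z 0 ∈ Set.Ioo ((0 : ℚ) : ℝ) ((1 : ℚ) : ℝ)}
      (fun z => (fun _ : ℝ => (0 : ℝ)) (z 0)) := by
    simpa using isSemialgebraicFunOn_natCast hb 0
  have hβ : IsSemialgebraicFunOn ℚ {z : Fin 1 → ℝ | z 0 ∈ Set.Ioo ((0 : ℚ) : ℝ) ((1 : ℚ) : ℝ)}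
      (fun z => (fun _ : ℝ => (1 : ℝ)) (z 0)) := by
    simpa using isSemialgebraicFunOn_natCast hb 1
  have hbd : ∃ M : ℝ, ∀ p ∈ zeroSquare.domain, |jumpF p| ≤ M := by
    refine ⟨1, fun p _ => ?_⟩
    unfold jumpF
    split_ifs <;> simp
  have hder : ∀ p ∈ zeroSquare.domain, p 0 ∈ Set.Ioo (((0 : ℚ)) : ℝ) ((1 : ℚ) : ℝ) →
      (fun _ : ℝ => (0 : ℝ)) (p 0) < p 1 → p 1 < (fun _ : ℝ => (1 : ℝ)) (p 0) → p ∉ (∅ : Set (Fin 2 → ℝ)) →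
      HasDerivAt (fun s : ℝ => jumpF ![p 0, s]) (zeroSquare.integrand p) (p 1) := by
    intro p _ _ _ hp1 _
    have hp1' : p 1 < 1 := hp1
    refine (hasDerivAt_const (p 1) (0 : ℝ)).congr_of_eventuallyEq ?_
    filter_upwards [Iio_mem_nhds hp1'] with s hs
    have hs' : s < 1 := hs
    simp [jumpF, hs']
  obtain ⟨r', hd, hi, hrel⟩ := h 0 1 (fun _ => 0) (fun _ => 1) jumpF ∅ zeroSquare
    zero_lt_one hα hβ (fun t _ => zero_le_one) closedSquareSet_eq_band isSemialgebraicFunOn_jumpF hbd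
    isSemialgebraic_empty measure_empty hder
  have hv : zeroSquare.value = r'.value := KZ.Equivalent.value_eq_holds hrel
  rw [value_zeroSquare, value_eq_of_const hd 1 fun z hz => by rw [hi z hz]; simp [jumpF]] at hv
  exact zero_ne_one hv

/-! ## (3) `α ≤ β` -/

/-- v3 `stub_bandNewtonLeibniz` with the hypothesis `∀ t ∈ (a₀,a₁), α t ≤ β t` DELETED. -/
def BandNLv3WithoutLE : Prop := ∀ (a₀ a₁ : ℚ) (α β : ℝ → ℝ) (F : (Fin 2 → ℝ) → ℝ)
    (Z : Set (Fin 2 → ℝ)) (r : KZ.IntegralRep 2), a₀ < a₁ →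
    IsSemialgebraicFunOn ℚ {z : Fin 1 → ℝ | z 0 ∈ Set.Ioo (a₀ : ℝ) a₁} (fun z => α (z 0)) →
    IsSemialgebraicFunOn ℚ {z : Fin 1 → ℝ | z 0 ∈ Set.Ioo (a₀ : ℝ) a₁} (fun z => β (z 0)) →
    r.domain = {p : Fin 2 → ℝ | p 0 ∈ Set.Icc (a₀ : ℝ) a₁ ∧ α (p 0) ≤ p 1 ∧ p 1 ≤ β (p 0)} →
    IsSemialgebraicFunOn ℚ r.domain F → (∃ M : ℝ, ∀ p ∈ r.domain, |F p| ≤ M) →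
    (∀ t ∈ Set.Ioo (a₀ : ℝ) a₁, ContinuousOn (fun s : ℝ => F ![t, s]) (Set.Icc (α t) (β t))) →
    IsSemialgebraic ℚ Z → volume Z = 0 →
    (∀ p ∈ r.domain, p 0 ∈ Set.Ioo (a₀ : ℝ) a₁ → α (p 0) < p 1 → p 1 < β (p 0) → p ∉ Z →
      HasDerivAt (fun s : ℝ => F ![p 0, s]) (r.integrand p) (p 1)) →
    ∃ r' : KZ.IntegralRep 1, r'.domain = {z : Fin 1 → ℝ | z 0 ∈ Set.Ioo (a₀ : ℝ) a₁} ∧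
      (∀ z ∈ r'.domain, r'.integrand z = F ![z 0, β (z 0)] - F ![z 0, α (z 0)]) ∧
      KZ.of r - KZ.of r' ∈ KZ.relations

/-- **`α ≤ β` is load-bearing in the v3 engine** (witness as in `not_bandNLWithoutLE`: `α = 1`,
`β = 0`, `F = y`, the empty band, bound `M = 0` vacuously). -/
theorem not_bandNLv3WithoutLE : ¬ BandNLv3WithoutLE := by
  intro h
  have hb : IsSemialgebraic ℚ {z : Fin 1 → ℝ | z 0 ∈ Set.Ioo ((0 : ℚ) : ℝ) ((1 : ℚ) : ℝ)} :=
    isSemialgebraic_baseSet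
  have hα : IsSemialgebraicFunOn ℚ {z : Fin 1 → ℝ | z 0 ∈ Set.Ioo ((0 : ℚ) : ℝ) ((1 : ℚ) : ℝ)}
      (fun z => (fun _ : ℝ => (1 : ℝ)) (z 0)) := by
    simpa using isSemialgebraicFunOn_natCast hb 1
  have hβ : IsSemialgebraicFunOn ℚ {z : Fin 1 → ℝ | z 0 ∈ Set.Ioo ((0 : ℚ) : ℝ) ((1 : ℚ) : ℝ)}
      (fun z => (fun _ : ℝ => (0 : ℝ)) (z 0)) := by
    simpa using isSemialgebraicFunOn_natCast hb 0
  have hF : IsSemialgebraicFunOn ℚ (KZ.IntegralRep.empty 2).domain (fun p : Fin 2 → ℝ => p 1) := by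
    rw [KZ.IntegralRep.domain_empty]
    exact isSemialgebraicFunOn_apply isSemialgebraic_empty 1
  have hbd : ∃ M : ℝ, ∀ p ∈ (KZ.IntegralRep.empty 2).domain, |(fun p : Fin 2 → ℝ => p 1) p| ≤ M :=
    ⟨0, fun p hp => (notMem_empty p hp).elim⟩
  obtain ⟨r', hd, hi, hrel⟩ := h 0 1 (fun _ => 1) (fun _ => 0) (fun p => p 1) ∅ (KZ.IntegralRep.empty 2)
    zero_lt_one hα hβ empty_domain_eq_band hF hbd (fun t _ => continuousOn_id.congr fun s _ => by simp)
    isSemialgebraic_empty measure_empty (fun p hp => (notMem_empty p hp).elim)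
  have hv : (KZ.IntegralRep.empty 2).value = r'.value := KZ.Equivalent.value_eq_holds hrel
  rw [KZ.IntegralRep.value_empty, value_eq_of_const hd (-1) fun z hz => by rw [hi z hz]; simp] at hv
  norm_num at hv

end Summit.KontsevichZagierPeriods.PlanarAreas.Negative.GreenBands

end
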